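import Literature.Analysis.Complex.AreaTheorem
import Literature.Analysis.Complex.SimplyConnectedOfCompl
import HarnessLib

/-!
# Bieberbach's theorem `|a₂| ≤ 2`

Trunk T-STOCH support (complex analysis). For `f(z) = z + a₂z² + …` holomorphic and injective
on the unit disc (the class `S`), `|a₂| ≤ 2` (Bieberbach 1916; Pommerenke, *Boundary Behaviour
of Conformal Maps* (1992), §1.3 eq. (9); Duren, *Univalent Functions* (1983), Thm. 2.2). This is
the input of the Koebe distortion theorem (Pommerenke Thm. 1.3).

Proof as in Pommerenke (3), (7)–(9): `g(ζ) = 1/f(1/ζ) ∈ Σ` omits `0` and has `b₀ = -a₂`; the odd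
function `h(ζ) = √(g(ζ²))` is again in `Σ`, with `b₁(h) = b₀(g)/2`, so `|a₂| = 2|b₁(h)| ≤ 2` by
the area theorem (`Literature.Analysis.Complex.AreaThm.norm_deriv_dslope_le_one`,
`Literature/Analysis/Complex/AreaTheorem.lean`). In disc coordinates: `ψ_g(z) = z/f(z) = 1/q(z)`,
`q = dslope f 0` (zero-free), `ψ_h(z) = r(z²)` with `r` a holomorphic square root of `ψ_g`,
`r(0) = 1` (`Complex.HasSqrt` of the disc), and `(dslope ψ_h 0)'(0) = r'(0) = -a₂/2`.

* `norm_deriv_dslope_le_two`: `‖(dslope f 0)'(0)‖ ≤ 2` for `f ∈ S` (`a₂ = (dslope f 0)'(0)`);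
* `deriv_deriv_eq_two_mul`: `f''(0) = 2 (dslope f 0)'(0)`, so `‖f''(0)‖ ≤ 4`
  (`norm_deriv_deriv_le_four`), and for an arbitrary conformal map of the disc
  `‖f''(0)‖ ≤ 4 ‖f'(0)‖` (`norm_deriv_deriv_le_four_mul`).

Mathlib has no univalent-function theory (searched `Bieberbach`, `univalent`, `schlicht`).

## References

* Ch. Pommerenke, *Boundary Behaviour of Conformal Maps*, Springer (1992), §1.3, (3), (7)–(9).
* P. L. Duren, *Univalent Functions*, Springer (1983), §2.2, Thm. 2.2.
-/

noncomputable section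

open Set Filter Metric Topology Complex
open scoped ComplexConjugate

namespace Literature.Analysis.Complex

namespace AreaThm

variable {f : ℂ → ℂ}

/-! ### The second coefficient via `dslope` -/

/-- **`f''(0) = 2 (dslope f 0)'(0)`** for `f` holomorphic on the unit disc: with `q = dslope f 0`,
`f(z) = f(0) + z q(z)`, so `f' = q + z q'` and `f''(0) = 2q'(0)`. [folklore] -/
theorem deriv_deriv_eq_two_mul (hf : DifferentiableOn ℂ f (ball 0 1)) :
    deriv (deriv f) 0 = 2 * deriv (dslope f 0) 0 := by
  set q := dslope f 0 with hq
  have h0 : (0 : ℂ) ∈ ball (0 : ℂ) 1 := mem_ball_self one_pos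
  have hqd : DifferentiableOn ℂ q (ball 0 1) :=
    (Complex.differentiableOn_dslope (isOpen_ball.mem_nhds h0)).2 hf
  have hq'd : DifferentiableOn ℂ (deriv q) (ball 0 1) := differentiableOn_deriv isOpen_ball hqd
  -- `f' = q + z q'` on the disc
  have hderiv : ∀ z ∈ ball (0 : ℂ) 1, deriv f z = q z + z * deriv q z := by
    intro z hz
    have hfz : ∀ w, f w = f 0 + w * q w := fun w ↦ by
      have := sub_smul_dslope f 0 w
      rw [sub_zero, smul_eq_mul] at this
      rw [hq, this]; ring
    have hqz : HasDerivAt q (deriv q z) z := (hqd.differentiableAt (isOpen_ball.mem_nhds hz)).hasDerivAt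
    have h : HasDerivAt (fun w ↦ f 0 + w * q w) (1 * q z + z * deriv q z) z :=
      ((hasDerivAt_id z).mul hqz).const_add (f 0)
    have h' : HasDerivAt f (1 * q z + z * deriv q z) z :=
      h.congr_of_eventuallyEq (Eventually.of_forall fun w ↦ hfz w)
    rw [h'.deriv, one_mul]
  have hev : deriv f =ᶠ[𝓝 0] fun z ↦ q z + z * deriv q z :=
    Filter.eventuallyEq_of_mem (isOpen_ball.mem_nhds h0) hderiv
  rw [hev.deriv_eq]
  have hq0 : HasDerivAt q (deriv q 0) 0 := (hqd.differentiableAt (isOpen_ball.mem_nhds h0)).hasDerivAt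
  have hq'0 : HasDerivAt (deriv q) (deriv (deriv q) 0) 0 :=
    (hq'd.differentiableAt (isOpen_ball.mem_nhds h0)).hasDerivAt
  have h2 : HasDerivAt (fun z ↦ q z + z * deriv q z)
      (deriv q 0 + (1 * deriv q 0 + 0 * deriv (deriv q) 0)) 0 := hq0.add ((hasDerivAt_id 0).mul hq'0)
  rw [h2.deriv]
  ring

/-! ### Bieberbach's theorem -/

/-- **Bieberbach's theorem `|a₂| ≤ 2`** (Pommerenke (1992), §1.3 eq. (9)): for `f` holomorphic and
injective on the unit disc with `f(0) = 0`, `f'(0) = 1`, the second coefficient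
`a₂ = (dslope f 0)'(0) = f''(0)/2` satisfies `‖a₂‖ ≤ 2`. Proof: the odd square-root transform
of `1/f(1/ζ)` and the area theorem. [cite: PommerenkeBBCM1992, §1.3 eq. (9)] -/
theorem norm_deriv_dslope_le_two (hf : DifferentiableOn ℂ f (ball 0 1)) (hinj : InjOn f (ball 0 1))
    (hf0 : f 0 = 0) (hf1 : deriv f 0 = 1) : ‖deriv (dslope f 0) 0‖ ≤ 2 := by
  have h0 : (0 : ℂ) ∈ ball (0 : ℂ) 1 := mem_ball_self one_pos
  set q := dslope f 0 with hq
  have hqd : DifferentiableOn ℂ q (ball 0 1) :=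
    (Complex.differentiableOn_dslope (isOpen_ball.mem_nhds h0)).2 hf
  have hq0 : q 0 = 1 := by rw [hq, dslope_same, hf1]
  have hfq : ∀ z, f z = z * q z := fun z ↦ by
    have := sub_smul_dslope f 0 z
    rw [sub_zero, smul_eq_mul, hf0, sub_zero] at this
    exact this.symm
  -- `q` is zero-free on the disc
  have hqne : ∀ z ∈ ball (0 : ℂ) 1, q z ≠ 0 := by
    intro z hz hqz
    by_cases hz0 : z = 0
    · rw [hz0, hq0] at hqz; exact one_ne_zero hqz
    · have : f z = f 0 := by rw [hfq z, hqz, mul_zero, hf0]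
      exact hz0 (hinj hz h0 this)
  -- `ψ = 1/q` and its square root `r` with `r 0 = 1`
  set ψ : ℂ → ℂ := fun z ↦ (q z)⁻¹ with hψ
  have hψd : DifferentiableOn ℂ ψ (ball 0 1) := hqd.inv hqne
  have hψne : ∀ z ∈ ball (0 : ℂ) 1, ψ z ≠ 0 := fun z hz ↦ inv_ne_zero (hqne z hz)
  obtain ⟨r₀, hr₀d, hr₀⟩ := (Complex.isSimplyConnected_ball.hasSqrt isOpen_ball).exists_forall_sq_eq
    hψd hψne
  have hr₀0 : r₀ 0 = 1 ∨ r₀ 0 = -1 := by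
    have : r₀ 0 ^ 2 = 1 := by rw [hr₀ 0]; simp [hψ, hq0]
    exact sq_eq_one_iff.1 this |>.imp id id
  -- normalise the sign
  obtain ⟨r, hrd, hr, hr0⟩ : ∃ r : ℂ → ℂ, DifferentiableOn ℂ r (ball 0 1) ∧ (∀ z, r z ^ 2 = ψ z) ∧
      r 0 = 1 := by
    rcases hr₀0 with h | h
    · exact ⟨r₀, hr₀d, hr₀, h⟩
    · exact ⟨fun z ↦ -r₀ z, hr₀d.neg, fun z ↦ by rw [neg_sq, hr₀ z], by simp [h]⟩
  have hrne : ∀ z ∈ ball (0 : ℂ) 1, r z ≠ 0 := fun z hz h ↦ hψne z hz (by rw [← hr z, h]; ring)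
  -- `r'(0) = ψ'(0)/2 = -q'(0)/2`
  have hrderiv : deriv r 0 = -deriv q 0 / 2 := by
    rw [Complex.deriv_of_sq_eq isOpen_ball hrd.continuousOn hψd (fun z _ ↦ hr z) h0 (hrne 0 h0), hr0]
    have hψ' : deriv ψ 0 = -deriv q 0 := by
      have h3 : HasDerivAt ψ (-(deriv q 0) / (q 0) ^ 2) 0 :=
        (hqd.differentiableAt (isOpen_ball.mem_nhds h0)).hasDerivAt.inv (hqne 0 h0)
      rw [h3.deriv, hq0]; simp
    rw [hψ']; ring
  -- the odd transform `ψ_h(z) = r(z²)`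
  set φ : ℂ → ℂ := fun z ↦ r (z ^ 2) with hφ
  have hsq_mem : ∀ z ∈ ball (0 : ℂ) 1, z ^ 2 ∈ ball (0 : ℂ) 1 := fun z hz ↦ by
    rw [mem_ball_zero_iff] at hz ⊢
    rw [norm_pow]
    nlinarith [norm_nonneg z]
  have hφd : DifferentiableOn ℂ φ (ball 0 1) :=
    hrd.comp (differentiableOn_pow 2) hsq_mem
  have hφ0 : φ 0 = 1 := by simp [hφ, hr0]
  -- injectivity of `z ↦ φ(z)/z` on the punctured disc
  have hinjφ : InjOn (fun z ↦ φ z / z) (ball (0 : ℂ) 1 \ {0}) := by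
    rintro z₁ ⟨hz₁, hz₁0⟩ z₂ ⟨hz₂, hz₂0⟩ heq
    have hz₁0 : z₁ ≠ 0 := hz₁0
    have hz₂0 : z₂ ≠ 0 := hz₂0
    simp only [hφ] at heq
    -- square: `ψ(z₁²)/z₁² = ψ(z₂²)/z₂²`, i.e. `1/f(z₁²) = 1/f(z₂²)`
    have hsq : (f (z₁ ^ 2))⁻¹ = (f (z₂ ^ 2))⁻¹ := by
      have h1 : ∀ z : ℂ, z ≠ 0 → (r (z ^ 2) / z) ^ 2 = (f (z ^ 2))⁻¹ := fun z hz ↦ by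
        rw [div_pow, hr, hψ, hfq (z ^ 2)]
        field_simp
      rw [← h1 z₁ hz₁0, ← h1 z₂ hz₂0, heq]
    have hff : f (z₁ ^ 2) = f (z₂ ^ 2) := inv_injective hsq
    have hzz : z₁ ^ 2 = z₂ ^ 2 := hinj (hsq_mem z₁ hz₁) (hsq_mem z₂ hz₂) hff
    rcases sq_eq_sq_iff_eq_or_eq_neg.1 hzz with h | h
    · exact h
    · -- `z₁ = -z₂` forces `r(z₂²) = 0`
      exfalso
      rw [h, neg_sq, div_neg] at heq
      have : r (z₂ ^ 2) / z₂ = 0 := by linear_combination (-(1 : ℂ) / 2) * heq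
      rw [div_eq_zero_iff] at this
      rcases this with h3 | h3
      · exact hrne _ (hsq_mem z₂ hz₂) h3
      · exact hz₂0 h3
  -- the area theorem for `φ`
  have harea := norm_deriv_dslope_le_one hφd hφ0 hinjφ
  -- `(dslope φ 0)'(0) = r'(0)`
  have hds : deriv (dslope φ 0) 0 = deriv r 0 := by
    set ρ := dslope r 0 with hρ
    have hρd : DifferentiableOn ℂ ρ (ball 0 1) :=
      (Complex.differentiableOn_dslope (isOpen_ball.mem_nhds h0)).2 hrd
    have heq : dslope φ 0 = fun z ↦ z * ρ (z ^ 2) := by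
      funext z
      by_cases hz : z = 0
      · subst hz
        rw [dslope_same, zero_mul]
        -- `φ'(0) = r'(0) · 2 · 0 = 0`
        have hr' : HasDerivAt r (deriv r ((0 : ℂ) ^ 2)) ((0 : ℂ) ^ 2) :=
          (hrd.differentiableAt (isOpen_ball.mem_nhds (by simp))).hasDerivAt
        have h := hr'.comp 0 (hasDerivAt_pow 2 (0 : ℂ))
        rw [show (r ∘ fun x : ℂ ↦ x ^ 2) = φ from rfl] at h
        rw [h.deriv]
        simp
      · rw [dslope_of_ne _ hz, slope_def_field, sub_zero, hφ0]
        have := sub_smul_dslope r 0 (z ^ 2)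
        rw [sub_zero, smul_eq_mul, hr0] at this
        rw [← hρ] at this
        rw [div_eq_iff hz]
        show r (z ^ 2) - 1 = z * ρ (z ^ 2) * z
        linear_combination -this
    rw [heq]
    have hρ0 : HasDerivAt (fun z : ℂ ↦ ρ (z ^ 2)) (deriv ρ (0 ^ 2) * (2 * 0 ^ 1)) 0 := by
      have hρ' : HasDerivAt ρ (deriv ρ ((0:ℂ) ^ 2)) ((0 : ℂ) ^ 2) :=
        (hρd.differentiableAt (isOpen_ball.mem_nhds (by simp))).hasDerivAt
      exact hρ'.comp 0 (hasDerivAt_pow 2 0)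
    have h5 : HasDerivAt (fun z : ℂ ↦ z * ρ (z ^ 2))
        (1 * ρ ((0 : ℂ) ^ 2) + 0 * (deriv ρ (0 ^ 2) * (2 * 0 ^ 1))) 0 := (hasDerivAt_id 0).mul hρ0
    rw [h5.deriv]
    simp [hρ, dslope_same]
  rw [hds, hrderiv] at harea
  rw [norm_div, norm_neg, RCLike.norm_ofNat, div_le_one (by norm_num)] at harea
  exact harea

/-- **`‖f''(0)‖ ≤ 4` for `f ∈ S`** (`f''(0) = 2a₂`, `deriv_deriv_eq_two_mul`).
[cite: PommerenkeBBCM1992, §1.3 eq. (9)] -/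
theorem norm_deriv_deriv_le_four (hf : DifferentiableOn ℂ f (ball 0 1)) (hinj : InjOn f (ball 0 1))
    (hf0 : f 0 = 0) (hf1 : deriv f 0 = 1) : ‖deriv (deriv f) 0‖ ≤ 4 := by
  rw [deriv_deriv_eq_two_mul hf, norm_mul, RCLike.norm_ofNat]
  linarith [norm_deriv_dslope_le_two hf hinj hf0 hf1]

/-- **`‖f''(0)‖ ≤ 4 ‖f'(0)‖` for every conformal map `f` of the unit disc** (Bieberbach's theorem
applied to `(f - f(0))/f'(0) ∈ S`; `f'(0) ≠ 0` by injectivity). [cite: PommerenkeBBCM1992, §1.3 eq. (9)] -/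
theorem norm_deriv_deriv_le_four_mul (hf : DifferentiableOn ℂ f (ball 0 1))
    (hinj : InjOn f (ball 0 1)) : ‖deriv (deriv f) 0‖ ≤ 4 * ‖deriv f 0‖ := by
  have h0 : (0 : ℂ) ∈ ball (0 : ℂ) 1 := mem_ball_self one_pos
  have hd0 : deriv f 0 ≠ 0 := SCV.deriv_ne_zero_of_injOn hf isOpen_ball hinj h0
  set c := deriv f 0 with hc
  set F : ℂ → ℂ := fun z ↦ (f z - f 0) / c with hF
  have hFd : DifferentiableOn ℂ F (ball 0 1) := (hf.sub_const _).div_const c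
  have hFinj : InjOn F (ball 0 1) := fun z₁ h₁ z₂ h₂ heq ↦ hinj h₁ h₂ (by
    have := heq
    simp only [hF] at this
    rw [div_left_inj' hd0] at this
    exact sub_left_injective this)
  have hF0 : F 0 = 0 := by simp [hF]
  have hderivF : ∀ z ∈ ball (0 : ℂ) 1, deriv F z = deriv f z / c := fun z hz ↦ by
    have h := ((hf.differentiableAt (isOpen_ball.mem_nhds hz)).hasDerivAt.sub_const (f 0)).div_const c
    exact h.deriv
  have hF1 : deriv F 0 = 1 := by rw [hderivF 0 h0, hc, div_self hd0]
  have hdd : deriv (deriv F) 0 = deriv (deriv f) 0 / c := by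
    have hev : deriv F =ᶠ[𝓝 0] fun z ↦ deriv f z / c :=
      Filter.eventuallyEq_of_mem (isOpen_ball.mem_nhds h0) hderivF
    rw [hev.deriv_eq]
    have hd' : DifferentiableOn ℂ (deriv f) (ball 0 1) := differentiableOn_deriv isOpen_ball hf
    exact ((hd'.differentiableAt (isOpen_ball.mem_nhds h0)).hasDerivAt.div_const c).deriv
  have h := norm_deriv_deriv_le_four hFd hFinj hF0 hF1
  rw [hdd, norm_div, div_le_iff₀ (norm_pos_iff.2 hd0)] at h
  exact h

end AreaThm

end Literature.Analysis.Complex
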